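/-
Copyright (c) 2026. Released under Apache 2.0 license.
-/
import Summits.RiemannHypothesis.RiemannHypothesis.Theorems.SemilocalCert554Data
import HarnessLib

/-!
# Semi-local threshold `a*({2})`, lower rung `b = 277/500`: the value of `κ` and the scalar side conditions (kernel evaluation, once)

Cell `rh-explicit` (HOME `run/shared/lean/pub/rh-explicit/`), seat cc-s2-2, block C⁺/B2.  The one-prime Stage-C certificate
`weilCert3S554 : WeilCert3` (`WeilFirstPrimeCertificateZ.lean`) at half-length `a₀ = b = 277/500 = 0.554`: cells = the 248 inner
first-prime cells of the tree's two-prime chain on `[0, 80]` (`cellsT80fp`, `SemilocalCert554Split.lean`; `prec = 120`,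
`j = 5`), one-prime level `levelT80fp ≈ 2.70861`, `T = 80`, `N = 149`; Legendre blocks `C`, `D` (`nb = 75`) and the factored
inverse `Dn/Ls` of `weilCert23P` (even) / `weilCert23E` (odd) BY NAME (their `D C = I` and `Dn` claim rows transfer by
definitional unfolding); new: the moment table (`pnu = 64`, each entry from the two-prime chain's kernel-verified partial sums
by `WeilCert3.checkNuAt_of_partsT80fp`), the materialized rounded moment blocks `P_r` (`WeilBlockRowsP.lean`), the Bessel
block claims `Hp = diag(2a₀/(2(2i+p)+1))`, the dyadic PSD factors `U`, and `κ`.  Generated by exact rational arithmetic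
mirroring the checker (`λ_min(S'_even) ≈ 5.82·10⁻⁸`, `λ_min(S'_odd) ≈ 7.20·10⁻⁶`; exact one-sided dominance slack
`2.9·10⁻⁸` / `3.6·10⁻⁶`).  Nothing about the data is trusted: the bridge `le_weilSemilocalThreshold_two_of_check_of_le`
consumes only the kernel-evaluated Boolean `weilCert3S554.check = true`.
-/

set_option linter.dupNamespace false  -- the mandated namespace repeats `RiemannHypothesis`

noncomputable section

namespace Summit.RiemannHypothesis.RiemannHypothesis.Theorems.SemilocalCert554

open Literature.NumberTheory.LFunctions

set_option maxHeartbeats 0 in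
/-- **The value of `κ`** of `weilCert3S554` (`ratRd 128 κ_exact`; kernel evaluation of the cell bounds and the `|γ|`-moment over the 248
cells `cellsT80fp`, once). [folklore] -/
theorem kappaQ_cert554 : weilCert3S554.kappaQ = cert554Kappa := by
  have h : decide (weilCert3S554.kappaQ = cert554Kappa) = true := by decide +kernel
  exact of_decide_eq_true h

set_option maxHeartbeats 0 in
/-- **Kernel check of the scalar side conditions** of `weilCert3S554` (`0 < b ≤ a₀ ≤ 1`, `2a₀T ≤ N+2`, Taylor remainder `≤ 1`,
`N+1 = 2nb`, `κ ≥ 0`), with `κ` replaced by its proved literal first. [folklore] -/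
theorem checkScalars_cert554 : weilCert3S554.checkScalars = true := by
  have h : weilCert3S554.checkScalars = (decide (1 ≤ weilCert3S554.j) && decide (0 < weilCert3S554.b) &&
      decide (weilCert3S554.b ≤ weilCert3S554.base.a0) && decide (weilCert3S554.base.a0 ≤ 1) && decide (0 < weilCert3S554.base.T) &&
      decide (2 * weilCert3S554.base.a0 * weilCert3S554.base.T ≤ (weilCert3S554.base.N : ℚ) + 2) &&
      decide (2 * (weilCert3S554.base.a0 * weilCert3S554.base.T) ^ (weilCert3S554.base.N + 1) / (weilCert3S554.base.N + 1).factorial ≤ 1) &&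
      decide (weilCert3S554.base.N + 1 = 2 * weilCert3S554.base.nb) && decide (0 ≤ weilCert3S554.kappaQ)) := rfl
  rw [h, kappaQ_cert554]
  decide +kernel

end Summit.RiemannHypothesis.RiemannHypothesis.Theorems.SemilocalCert554

end
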